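import Literature.MathematicalPhysics.QuantumFieldTheory.Balaban1983to89.B6RandomWalkL2
import Literature.MathematicalPhysics.QuantumFieldTheory.Balaban1983to89.B16Ineq17Assembly

/-!
# `Balaban1983to89.B16Ineq17ZetaError` — [Balaban1989LargeFieldII] p. 357 (the third printed step behind (1.7)):
# *«Replacing … the function ζ₀ by the function identically equal to 1, we change the form by a quadratic form bounded by
# O(exp(−R_k))»* — the `ζ₀ → 1` replacement error PROVED from a block-`ℓ²` decay majorant by a block Schur test, and (1.7)
# re-assembled with that half of the letter `hER` of `B16Ineq17Assembly.ineq17_of_inputs` discharged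

statement-level skeleton of published theorems with citation tags; proofs where landed; nothing here is a claim about
the Yang–Mills mass gap.

Cell pub-ymgap, HUMAN RULING D-0062 (Track A full width), seat `pub-ymgap-dag-n12-b` (-b FIRST-MISSING-ESTIMATE of DAG
node N12 = [B15] Prop. 1, whose only printed proof is [Balaban1989LargeFieldII] pp. 357–359; this file treats the FIRST
estimate of that proof which the tree carried only as a letter).  T. Bałaban, *Large field renormalization. II.
Localization, exponentiation, and bounds for the 𝐑 operation*, Commun. Math. Phys. **122** (1989) 355–392
[Balaban1989LargeFieldII] (cell paper B16; PDF held `paper:balaban1989-cmp122-large-field-ii`, journal page = PDF page +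
354; pp. 357–358 = PDF 3–4, text layer re-read by this seat 2026-08-25); the block-majorant calculus is that of T. Bałaban,
CMP **96** (1984) 223–250 [Balaban1984PropagatorsII] (2.51)–(2.52) p. 232, (2.140)–(2.141) p. 247, in the tree's `ℓ²` form
`B6RandomWalkL2` (p22).  SKELETON row `B16.Eq1.7` (owner r13): *«principal theorem `B16Ineq17Assembly.ineq17_of_inputs`
… ASSEMBLED from print's p.357 three steps»* — its HONEST SCOPE (c): *«the replacement error |E_R| ≤ C₂e^{−R_k}‖B′‖²
(exponential decay of the minimizer, R_k-separation)»* is a LETTER there.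

THE PRINT (p. 357 foot – p. 358 top, verbatim): *«Then we expand the expressions defining the quadratic form with respect
to A₀, up to the first order in A₀. This was discussed in Sect. B [13]. The leading term in the expansion is the
quadratic form with the background field identically equal to 1. Replacing the minimizer in this form by the kᵗʰ
minimizer defined on the whole lattice, and the function ζ₀ by the function identically equal to 1, we change the form
by a quadratic form bounded by O(exp(−R_k)). Now the leading quadratic form is equal to ⟨B′, Δ_kB′⟩ defined by (1.65),
(1.66) [10]. Using the bound (1.67) [10] for this form, we obtain ⟨H_{1,k}B′, Δ₁(ζ₀)H_{1,k}B′⟩ ≧ γ₀‖∂B′‖² −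
O(1)(M⁶R_kε_k + exp(−R_k))‖B′‖². (1.7)»*; p. 357 (1.6): *«By the exponential decay of the minimizer, and the
localizations of 1 − ζ₀ and B′, … exp(−δ dist(Ω_k, Λ)) …»* (the same geometry: `1 − ζ₀` and `B′` are `R_k`-separated,
`δ·dist ≥ R_k`, cf. r13's `B16Sect1Wilson.ineq16_arith`).

THE READING TYPED HERE (declared; referee columns F6/F7).  At the background field `1` the form is `Q(ζ) = ⟨H B′, Δ₁(ζ)
H B′⟩ = Σ_p ζ(p)·|(∂H B′)(p)|²` (the `ζ`-weighted Wilson quadratic form of the linearised curvature of the minimizer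
`H B′`, `H = H_{1,k}` resp. the whole-lattice `H_k`; one 𝔤-component at a time — components add).  Hence the `ζ₀ → 1`
replacement error is `E_ζ = Q(ζ₀) − Q(1) = −Σ_p (1 − ζ₀(p))·|(∂HB′)(p)|²`, `0 ≤ 1 − ζ₀ ≤ 1` supported on the blocks `S`
far from `Λ`, `B′` supported on the blocks `S′` of `Λ`, `d(y, y′) ≥ R` on `S × S′`; *«the exponential decay of the
minimizer»* = a block-`ℓ²` majorant `K(y,y′) ≤ C·e^{−δd(y,y′)}` of `T = ∂∘H` ((2.140)-type input, [13]/[11]); the row∕column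
sums of `e^{−(δ/2)d}` are bounded by `c, c′` ((2.61) of [11]).  Then the BLOCK SCHUR TEST gives `|E_ζ| ≤ Σ_{y∈S}‖Δ(y)TB′‖²
≤ C²cc′·e^{−δR}·‖B′‖²` — print's `O(exp(−R_k))‖B′‖²` once `R_k ≤ δR`.

WHAT IS PROVED (0 `sorry`, no `def`, no new `Prop`; Mathlib + `B6RandomWalkL2` + `B16Ineq17Assembly`; axioms standard).
Generic over `g : B6.Geometry`, finite index types `X` (inputs, block map `blkX`) and `Y` (outputs, `blkY`), a linear
`T : (X → ℝ) →ₗ[ℝ] (Y → ℝ)` with a block-`ℓ²` majorant `K ≥ 0` in the HOM shape `‖Δ(y)Tu‖ ≤ K(y,y′)‖u‖` for `supp u ⊂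
Δ(y′)` (for `X = Y` this is p22's `B6RandomWalkL2.HasL2Majorant`, `hom_of_hasL2Majorant`):
§1 `l2n_sq_eq_sum_blockPiece_sq` (`‖v‖² = Σ_y ‖Δ(y)v‖²`), `sum_blockPiece_sq_eq_sum_ite` (`Σ_{y∈S}‖Δ(y)v‖² = Σ_{blk x∈S}
   v(x)²`), `l2n_blockPiece_apply_le_sum` (`‖Δ(y)Tu‖ ≤ Σ_{y′}K(y,y′)‖Δ(y′)u‖`).
§2 **`blockSchur`** — the block Schur test: row sums `Σ_{y′∈S′}K(y,y′) ≤ A` (`y ∈ S`), column sums `Σ_{y∈S}K(y,y′) ≤ A′`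
   (`y′ ∈ S′`), `supp u ⊂` blocks of `S′` ⇒ `Σ_{y∈S}‖Δ(y)Tu‖² ≤ A·A′·‖u‖²`; **`blockSchur_exp`** — with `K ≤ Ce^{−δd}`,
   separation `d ≥ R` on `S × S′` and the half-rate row∕column sums `≤ c, c′`: `Σ_{y∈S}‖Δ(y)Tu‖² ≤ C²cc′e^{−δR}‖u‖²`.
§3 **`zetaError_le`** — the `ζ₀ → 1` error: for a weight `0 ≤ w ≤ 1` supported over the blocks of `S` (`w = 1 − ζ₀`),
   `|Σ_x w(x)(Tu)(x)²| ≤ C²cc′e^{−δR}‖u‖²`; `zetaError_le_exp_Rk` — `≤ C²cc′·e^{−R_k}·‖u‖²` once `R_k ≤ δR`.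
§4 **`ineq17_of_inputs_zeta`** — (1.7) RE-ASSEMBLED through r13's `ineq17_of_inputs` with the replacement letter SPLIT
   `E_R = E_H + E_ζ`: `E_H` (*«replacing the minimizer … by the kᵗʰ minimizer defined on the whole lattice»*, letter
   `|E_H| ≤ C_H e^{−R_k}‖B′‖²`) and `E_ζ` PROVED as in §3 ⇒ `Ineq17 Q ‖∂B′‖² ‖B′‖² γ₀ (max C₁ (C_H + C²cc′)) M R_k ε_k`.

HONEST SCOPE (located, nothing repaired).  (i) The identification `Q(ζ) = Σ_p ζ(p)|(∂HB′)(p)|²` at background `1`, the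
operator `T = ∂∘H_{1,k}` and its block-`ℓ²` decay majorant ((2.140)-type, [13] Sect. B ∕ [11] Prop. 2.6 at k levels —
cf. the cell's `B6Ineq2140*KLevelV1` files) are DATA ∕ HYPOTHESES of the printed shapes; the row∕column sums are (2.61)
of [11] (`B11SectG.RowSum` shape) taken as hypotheses on the two block families.  (ii) The other half of the replacement
error (`H_{1,k,Z} → H_k`, a [13] localisation statement) and the first-order error `E_A` (*«|A₀|, |∇^ηA₀| <
O(1)M⁶R_kε_k … Sect. B [13]»*) remain LETTERS exactly as in r13's file.  (iii) `ℓ²` sizes are unweighted on both sides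
(p22's convention).  Value = one of the three printed steps behind (1.7) — the first estimate of the printed proof of
[IV] Prop. 1 that the tree held only as a letter — is now a kernel theorem from ONE typed published shape (the decay
majorant) plus the located geometry; count-neutral; NOT summit progress.
-/

noncomputable section

open scoped BigOperators
open Finset

namespace Literature.MathematicalPhysics.QuantumFieldTheory.Balaban1983to89.B16Ineq17ZetaError

open B6RandomWalk (blockPiece sum_blockPiece)
open B6RandomWalkL2 (l2n l2n_nonneg l2n_zero l2n_sq l2n_sum_le blockPiece_sum blockPiece_off HasL2Majorant)
open B16Sect1Wilson (Ineq17)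

variable {g : B6.Geometry} {X Y : Type} [Fintype X] [Fintype Y] (blkX : X → g.Site) (blkY : Y → g.Site)

/-! ## §1. Pieces and the `ℓ²` size -/

/-- `‖v‖² = Σ_y ‖Δ(y)v‖²`: the blocks partition the lattice ((2.4), *«Σ_y Δ(y) = I»* (2.52)), so the squared `ℓ²` size is the
sum of the squared sizes of the pieces. [cite: Balaban1984PropagatorsII, (2.52) p.232] -/
theorem l2n_sq_eq_sum_blockPiece_sq (v : Y → ℝ) : l2n v ^ 2 = ∑ y : g.Site, l2n (blockPiece blkY y v) ^ 2 := by
  classical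
  simp_rw [l2n_sq]
  rw [Finset.sum_comm]
  refine Finset.sum_congr rfl fun x _ => ?_
  have h : ∀ y : g.Site, blockPiece blkY y v x ^ 2 = if blkY x = y then v x ^ 2 else 0 := by
    intro y
    by_cases hy : blkY x = y <;> simp [blockPiece, hy]
  simp_rw [h]
  rw [Finset.sum_ite_eq]
  simp

/-- `Σ_{y∈S} ‖Δ(y)v‖² = Σ_{x : blk x ∈ S} v(x)²` (the pieces over a block family collect the values over its blocks).
[cite: Balaban1984PropagatorsII, (2.52) p.232] -/
theorem sum_blockPiece_sq_eq_sum_ite [DecidableEq g.Site] (S : Finset g.Site) (v : Y → ℝ) :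
    ∑ y ∈ S, l2n (blockPiece blkY y v) ^ 2 = ∑ x : Y, if blkY x ∈ S then v x ^ 2 else 0 := by
  simp_rw [l2n_sq]
  rw [Finset.sum_comm]
  refine Finset.sum_congr rfl fun x _ => ?_
  have h : ∀ y : g.Site, blockPiece blkY y v x ^ 2 = if blkY x = y then v x ^ 2 else 0 := by
    intro y
    by_cases hy : blkY x = y <;> simp [blockPiece, hy]
  simp_rw [h]
  rw [Finset.sum_ite_eq]

/-- `‖Δ(y)Tu‖ ≤ Σ_{y′} K(y,y′)‖Δ(y′)u‖` for ANY input `u`: decompose `u = Σ_{y′}Δ(y′)u` and apply the block majorant piece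
by piece (*«this property is preserved under … A summation»*). [cite: Balaban1984PropagatorsII, (2.52) p.232] -/
theorem l2n_blockPiece_apply_le_sum (T : (X → ℝ) →ₗ[ℝ] (Y → ℝ)) {K : g.Site → g.Site → ℝ}
    (hT : ∀ (y y' : g.Site) (u : X → ℝ), (∀ x, blkX x ≠ y' → u x = 0) →
      l2n (blockPiece blkY y (T u)) ≤ K y y' * l2n u)
    (y : g.Site) (u : X → ℝ) :
    l2n (blockPiece blkY y (T u)) ≤ ∑ y' : g.Site, K y y' * l2n (blockPiece blkX y' u) := by
  classical
  conv_lhs => rw [← sum_blockPiece blkX u, map_sum, blockPiece_sum]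
  exact (l2n_sum_le _ _).trans (Finset.sum_le_sum fun y' _ => hT y y' _ (blockPiece_off blkX y' u))

/-- For `X = Y` and one block map, the HOM-shape hypothesis of this file IS p22's `HasL2Majorant` (dictionary, `Iff.rfl`).
[cite: Balaban1984PropagatorsII, (2.140) p.247] -/
theorem hom_iff_hasL2Majorant (T : Module.End ℝ (X → ℝ)) (K : g.Site → g.Site → ℝ) :
    (∀ (y y' : g.Site) (u : X → ℝ), (∀ x, blkX x ≠ y' → u x = 0) →
      l2n (blockPiece blkX y (T u)) ≤ K y y' * l2n u) ↔ HasL2Majorant blkX T K :=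
  Iff.rfl

/-! ## §2. The block Schur test -/

/-- **BLOCK SCHUR TEST.**  Let `T` have the block-`ℓ²` majorant `K ≥ 0` (hom shape), let `S` (output blocks) and `S′`
(input blocks) be block families with ROW sums `Σ_{y′∈S′}K(y,y′) ≤ A` for `y ∈ S` (`A ≥ 0`) and COLUMN sums
`Σ_{y∈S}K(y,y′) ≤ A′` for `y′ ∈ S′`, and let `u` be supported over the blocks of `S′`.  Then
`Σ_{y∈S}‖Δ(y)Tu‖² ≤ A·A′·‖u‖²` (Cauchy–Schwarz in each row with the weights `K(y,·)`, then the column sums).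
[cite: Balaban1984PropagatorsII, (2.52) p.232, (2.140)–(2.141) p.247] -/
theorem blockSchur (T : (X → ℝ) →ₗ[ℝ] (Y → ℝ)) {K : g.Site → g.Site → ℝ}
    (hT : ∀ (y y' : g.Site) (u : X → ℝ), (∀ x, blkX x ≠ y' → u x = 0) →
      l2n (blockPiece blkY y (T u)) ≤ K y y' * l2n u)
    (hK : ∀ a b, 0 ≤ K a b) (S S' : Finset g.Site) {A A' : ℝ} (hA : 0 ≤ A)
    (hrow : ∀ y ∈ S, ∑ y' ∈ S', K y y' ≤ A) (hcol : ∀ y' ∈ S', ∑ y ∈ S, K y y' ≤ A')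
    (u : X → ℝ) (hu : ∀ x, blkX x ∉ S' → u x = 0) :
    ∑ y ∈ S, l2n (blockPiece blkY y (T u)) ^ 2 ≤ A * A' * l2n u ^ 2 := by
  classical
  -- the sizes of the input pieces, vanishing off `S′`
  set a : g.Site → ℝ := fun y' => l2n (blockPiece blkX y' u) with ha
  have ha0 : ∀ y', 0 ≤ a y' := fun y' => l2n_nonneg _
  have ha_off : ∀ y', y' ∉ S' → a y' = 0 := by
    intro y' hy'
    have h0 : blockPiece blkX y' u = 0 := by
      funext x
      by_cases hx : blkX x = y'
      · have hxS : blkX x ∉ S' := by rw [hx]; exact hy'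
        simp [blockPiece, hu x hxS]
      · simp [blockPiece, hx]
    simp only [ha, h0, l2n_zero]
  -- each output piece: `‖Δ(y)Tu‖ ≤ Σ_{y′∈S′} K(y,y′) a_{y′}`
  have h1 : ∀ y, l2n (blockPiece blkY y (T u)) ≤ ∑ y' ∈ S', K y y' * a y' := by
    intro y
    refine (l2n_blockPiece_apply_le_sum blkX blkY T hT y u).trans (le_of_eq ?_)
    symm
    refine Finset.sum_subset (Finset.subset_univ S') fun y' _ hy' => ?_
    rw [ha_off y' hy', mul_zero]
  -- Cauchy–Schwarz in each row
  have h2 : ∀ y ∈ S, l2n (blockPiece blkY y (T u)) ^ 2 ≤ A * ∑ y' ∈ S', K y y' * a y' ^ 2 := by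
    intro y hy
    have hsq : l2n (blockPiece blkY y (T u)) ^ 2 ≤ (∑ y' ∈ S', K y y' * a y') ^ 2 :=
      pow_le_pow_left₀ (l2n_nonneg _) (h1 y) 2
    have hcs : (∑ y' ∈ S', K y y' * a y') ^ 2 ≤ (∑ y' ∈ S', K y y') * ∑ y' ∈ S', K y y' * a y' ^ 2 :=
      Finset.sum_sq_le_sum_mul_sum_of_sq_le_mul S' (fun y' _ => hK y y')
        (fun y' _ => mul_nonneg (hK y y') (sq_nonneg _)) (fun y' _ => by ring_nf; rfl)
    have hg0 : 0 ≤ ∑ y' ∈ S', K y y' * a y' ^ 2 :=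
      Finset.sum_nonneg fun y' _ => mul_nonneg (hK y y') (sq_nonneg _)
    exact hsq.trans (hcs.trans (mul_le_mul_of_nonneg_right (hrow y hy) hg0))
  -- sum over the rows, exchange, column sums
  have h3 : ∑ y ∈ S, ∑ y' ∈ S', K y y' * a y' ^ 2 = ∑ y' ∈ S', a y' ^ 2 * ∑ y ∈ S, K y y' := by
    rw [Finset.sum_comm]
    refine Finset.sum_congr rfl fun y' _ => ?_
    rw [Finset.mul_sum]
    refine Finset.sum_congr rfl fun y _ => ?_
    ring
  have h4 : ∑ y' ∈ S', a y' ^ 2 * ∑ y ∈ S, K y y' ≤ ∑ y' ∈ S', a y' ^ 2 * A' :=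
    Finset.sum_le_sum fun y' hy' => mul_le_mul_of_nonneg_left (hcol y' hy') (sq_nonneg _)
  have h5 : ∑ y' ∈ S', a y' ^ 2 = ∑ y' : g.Site, a y' ^ 2 :=
    Finset.sum_subset (Finset.subset_univ S') fun y' _ hy' => by rw [ha_off y' hy']; ring
  have h6 : ∑ y' : g.Site, a y' ^ 2 = l2n u ^ 2 := by
    rw [l2n_sq_eq_sum_blockPiece_sq blkX u]
  calc ∑ y ∈ S, l2n (blockPiece blkY y (T u)) ^ 2
      ≤ ∑ y ∈ S, A * ∑ y' ∈ S', K y y' * a y' ^ 2 := Finset.sum_le_sum h2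
    _ = A * ∑ y' ∈ S', a y' ^ 2 * ∑ y ∈ S, K y y' := by rw [← Finset.mul_sum, h3]
    _ ≤ A * ∑ y' ∈ S', a y' ^ 2 * A' := mul_le_mul_of_nonneg_left h4 hA
    _ = A * A' * l2n u ^ 2 := by rw [← Finset.sum_mul, h5, h6]; ring

/-- **Block Schur with exponential kernels and separation.**  If `K(y,y′) ≤ C·e^{−δd(y,y′)}` (`C, δ ≥ 0`, `K ≥ 0`), the
families are separated, `d(y,y′) ≥ R` for `y ∈ S`, `y′ ∈ S′`, and the half-rate row∕column sums satisfy
`Σ_{y′∈S′}e^{−(δ/2)d(y,y′)} ≤ c` (`y ∈ S`), `Σ_{y∈S}e^{−(δ/2)d(y,y′)} ≤ c′` (`y′ ∈ S′`) ((2.61) of [11]), then for `u`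
supported over the blocks of `S′`: `Σ_{y∈S}‖Δ(y)Tu‖² ≤ C²cc′·e^{−δR}·‖u‖²` (split `e^{−δd} = e^{−δd/2}e^{−δd/2} ≤
e^{−δR/2}e^{−(δ/2)d}`). [cite: Balaban1984PropagatorsII, (2.61) p.234, (2.140) p.247; Balaban1989LargeFieldII, p.357
(«by the exponential decay of the minimizer»)] -/
theorem blockSchur_exp (T : (X → ℝ) →ₗ[ℝ] (Y → ℝ)) {K : g.Site → g.Site → ℝ}
    (hT : ∀ (y y' : g.Site) (u : X → ℝ), (∀ x, blkX x ≠ y' → u x = 0) →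
      l2n (blockPiece blkY y (T u)) ≤ K y y' * l2n u)
    (hK0 : ∀ a b, 0 ≤ K a b) {C δ R c c' : ℝ} (hC : 0 ≤ C) (hδ : 0 ≤ δ) (hc : 0 ≤ c)
    (hK : ∀ a b, K a b ≤ C * Real.exp (-(δ * g.dist a b))) (S S' : Finset g.Site)
    (hsep : ∀ y ∈ S, ∀ y' ∈ S', R ≤ g.dist y y')
    (hrow : ∀ y ∈ S, ∑ y' ∈ S', Real.exp (-(δ / 2 * g.dist y y')) ≤ c)
    (hcol : ∀ y' ∈ S', ∑ y ∈ S, Real.exp (-(δ / 2 * g.dist y y')) ≤ c')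
    (u : X → ℝ) (hu : ∀ x, blkX x ∉ S' → u x = 0) :
    ∑ y ∈ S, l2n (blockPiece blkY y (T u)) ^ 2 ≤ C ^ 2 * c * c' * Real.exp (-(δ * R)) * l2n u ^ 2 := by
  -- the split of the kernel on separated pairs
  have hsplit : ∀ y ∈ S, ∀ y' ∈ S',
      K y y' ≤ C * Real.exp (-(δ * R / 2)) * Real.exp (-(δ / 2 * g.dist y y')) := by
    intro y hy y' hy'
    have hd : R ≤ g.dist y y' := hsep y hy y' hy'
    have h1 : Real.exp (-(δ * g.dist y y')) ≤ Real.exp (-(δ * R / 2)) * Real.exp (-(δ / 2 * g.dist y y')) := by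
      rw [← Real.exp_add]
      exact Real.exp_le_exp.mpr (by nlinarith [mul_le_mul_of_nonneg_left hd hδ])
    calc K y y' ≤ C * Real.exp (-(δ * g.dist y y')) := hK y y'
      _ ≤ C * (Real.exp (-(δ * R / 2)) * Real.exp (-(δ / 2 * g.dist y y'))) := mul_le_mul_of_nonneg_left h1 hC
      _ = C * Real.exp (-(δ * R / 2)) * Real.exp (-(δ / 2 * g.dist y y')) := by ring
  have hE0 : 0 ≤ C * Real.exp (-(δ * R / 2)) := mul_nonneg hC (Real.exp_pos _).le
  -- row and column bounds
  have hrow' : ∀ y ∈ S, ∑ y' ∈ S', K y y' ≤ C * Real.exp (-(δ * R / 2)) * c := by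
    intro y hy
    calc ∑ y' ∈ S', K y y' ≤ ∑ y' ∈ S', C * Real.exp (-(δ * R / 2)) * Real.exp (-(δ / 2 * g.dist y y')) :=
          Finset.sum_le_sum fun y' hy' => hsplit y hy y' hy'
      _ = C * Real.exp (-(δ * R / 2)) * ∑ y' ∈ S', Real.exp (-(δ / 2 * g.dist y y')) := by rw [Finset.mul_sum]
      _ ≤ C * Real.exp (-(δ * R / 2)) * c := mul_le_mul_of_nonneg_left (hrow y hy) hE0
  have hcol' : ∀ y' ∈ S', ∑ y ∈ S, K y y' ≤ C * Real.exp (-(δ * R / 2)) * c' := by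
    intro y' hy'
    calc ∑ y ∈ S, K y y' ≤ ∑ y ∈ S, C * Real.exp (-(δ * R / 2)) * Real.exp (-(δ / 2 * g.dist y y')) :=
          Finset.sum_le_sum fun y hy => hsplit y hy y' hy'
      _ = C * Real.exp (-(δ * R / 2)) * ∑ y ∈ S, Real.exp (-(δ / 2 * g.dist y y')) := by rw [Finset.mul_sum]
      _ ≤ C * Real.exp (-(δ * R / 2)) * c' := mul_le_mul_of_nonneg_left (hcol y' hy') hE0
  have h := blockSchur blkX blkY T hT hK0 S S' (mul_nonneg hE0 hc) hrow' hcol' u hu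
  have hexp : Real.exp (-(δ * R / 2)) * Real.exp (-(δ * R / 2)) = Real.exp (-(δ * R)) := by
    rw [← Real.exp_add]; congr 1; ring
  calc ∑ y ∈ S, l2n (blockPiece blkY y (T u)) ^ 2
      ≤ C * Real.exp (-(δ * R / 2)) * c * (C * Real.exp (-(δ * R / 2)) * c') * l2n u ^ 2 := h
    _ = C ^ 2 * c * c' * (Real.exp (-(δ * R / 2)) * Real.exp (-(δ * R / 2))) * l2n u ^ 2 := by ring
    _ = C ^ 2 * c * c' * Real.exp (-(δ * R)) * l2n u ^ 2 := by rw [hexp]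

/-! ## §3. The `ζ₀ → 1` replacement error of p. 357 -/

/-- **The `ζ₀ → 1` error** (*«Replacing … the function ζ₀ by the function identically equal to 1, we change the form by a
quadratic form bounded by O(exp(−R_k))»*): for a weight `0 ≤ w ≤ 1` supported over the blocks of `S` (`w = 1 − ζ₀`), an
input `u = B′` supported over the blocks of `S′` (`Λ`), and `T = ∂∘H` as in `blockSchur_exp`:
`|Σ_x w(x)·(Tu)(x)²| ≤ C²cc′·e^{−δR}·‖u‖²`. [cite: Balaban1989LargeFieldII, p.357 (the sentence before (1.7)), (1.7) p.358] -/
theorem zetaError_le (T : (X → ℝ) →ₗ[ℝ] (Y → ℝ)) {K : g.Site → g.Site → ℝ}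
    (hT : ∀ (y y' : g.Site) (u : X → ℝ), (∀ x, blkX x ≠ y' → u x = 0) →
      l2n (blockPiece blkY y (T u)) ≤ K y y' * l2n u)
    (hK0 : ∀ a b, 0 ≤ K a b) {C δ R c c' : ℝ} (hC : 0 ≤ C) (hδ : 0 ≤ δ) (hc : 0 ≤ c)
    (hK : ∀ a b, K a b ≤ C * Real.exp (-(δ * g.dist a b))) (S S' : Finset g.Site)
    (hsep : ∀ y ∈ S, ∀ y' ∈ S', R ≤ g.dist y y')
    (hrow : ∀ y ∈ S, ∑ y' ∈ S', Real.exp (-(δ / 2 * g.dist y y')) ≤ c)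
    (hcol : ∀ y' ∈ S', ∑ y ∈ S, Real.exp (-(δ / 2 * g.dist y y')) ≤ c')
    (w : Y → ℝ) (hw0 : ∀ x, 0 ≤ w x) (hw1 : ∀ x, w x ≤ 1) (hwS : ∀ x, w x ≠ 0 → blkY x ∈ S)
    (u : X → ℝ) (hu : ∀ x, blkX x ∉ S' → u x = 0) :
    |∑ x : Y, w x * T u x ^ 2| ≤ C ^ 2 * c * c' * Real.exp (-(δ * R)) * l2n u ^ 2 := by
  classical
  have hnn : 0 ≤ ∑ x : Y, w x * T u x ^ 2 := Finset.sum_nonneg fun x _ => mul_nonneg (hw0 x) (sq_nonneg _)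
  rw [abs_of_nonneg hnn]
  -- `Σ_x w (Tu)² ≤ Σ_{blk x ∈ S} (Tu)² = Σ_{y∈S} ‖Δ(y)Tu‖²`
  have hpt : ∀ x : Y, w x * T u x ^ 2 ≤ if blkY x ∈ S then T u x ^ 2 else 0 := by
    intro x
    by_cases hx : blkY x ∈ S
    · rw [if_pos hx]
      calc w x * T u x ^ 2 ≤ 1 * T u x ^ 2 := mul_le_mul_of_nonneg_right (hw1 x) (sq_nonneg _)
        _ = T u x ^ 2 := one_mul _
    · have hw : w x = 0 := by
        by_contra hne
        exact hx (hwS x hne)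
      rw [if_neg hx, hw, zero_mul]
  calc ∑ x : Y, w x * T u x ^ 2 ≤ ∑ x : Y, (if blkY x ∈ S then T u x ^ 2 else 0) := Finset.sum_le_sum fun x _ => hpt x
    _ = ∑ y ∈ S, l2n (blockPiece blkY y (T u)) ^ 2 := (sum_blockPiece_sq_eq_sum_ite blkY S (T u)).symm
    _ ≤ C ^ 2 * c * c' * Real.exp (-(δ * R)) * l2n u ^ 2 :=
        blockSchur_exp blkX blkY T hT hK0 hC hδ hc hK S S' hsep hrow hcol u hu

/-- The same in print's letter: with the `R_k`-separation `R_k ≤ δR` (*«exp(−δ dist(Ω_k, Λ))»*, `δ·dist ≥ R_k` as in (1.6)),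
`|E_ζ| ≤ C²cc′·e^{−R_k}·‖u‖²` — the shape `|E_R| ≤ C₂e^{−R_k}‖B′‖²` of the letter `hER` of `B16Ineq17Assembly.ineq17_of_inputs`.
[cite: Balaban1989LargeFieldII, (1.6)–(1.7) pp.357–358] -/
theorem zetaError_le_exp_Rk (T : (X → ℝ) →ₗ[ℝ] (Y → ℝ)) {K : g.Site → g.Site → ℝ}
    (hT : ∀ (y y' : g.Site) (u : X → ℝ), (∀ x, blkX x ≠ y' → u x = 0) →
      l2n (blockPiece blkY y (T u)) ≤ K y y' * l2n u)
    (hK0 : ∀ a b, 0 ≤ K a b) {C δ R c c' Rk : ℝ} (hC : 0 ≤ C) (hδ : 0 ≤ δ) (hc : 0 ≤ c) (hc' : 0 ≤ c')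
    (hK : ∀ a b, K a b ≤ C * Real.exp (-(δ * g.dist a b))) (S S' : Finset g.Site)
    (hsep : ∀ y ∈ S, ∀ y' ∈ S', R ≤ g.dist y y')
    (hrow : ∀ y ∈ S, ∑ y' ∈ S', Real.exp (-(δ / 2 * g.dist y y')) ≤ c)
    (hcol : ∀ y' ∈ S', ∑ y ∈ S, Real.exp (-(δ / 2 * g.dist y y')) ≤ c') (hRk : Rk ≤ δ * R)
    (w : Y → ℝ) (hw0 : ∀ x, 0 ≤ w x) (hw1 : ∀ x, w x ≤ 1) (hwS : ∀ x, w x ≠ 0 → blkY x ∈ S)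
    (u : X → ℝ) (hu : ∀ x, blkX x ∉ S' → u x = 0) :
    |∑ x : Y, w x * T u x ^ 2| ≤ C ^ 2 * c * c' * Real.exp (-Rk) * l2n u ^ 2 := by
  have h := zetaError_le blkX blkY T hT hK0 hC hδ hc hK S S' hsep hrow hcol w hw0 hw1 hwS u hu
  have hexp : Real.exp (-(δ * R)) ≤ Real.exp (-Rk) := Real.exp_le_exp.mpr (by linarith)
  have hpre : 0 ≤ C ^ 2 * c * c' := by positivity
  exact h.trans (mul_le_mul_of_nonneg_right (mul_le_mul_of_nonneg_left hexp hpre) (sq_nonneg _))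

/-! ## §4. (1.7) re-assembled with the `ζ₀ → 1` half of the replacement letter discharged -/

/-- **(1.7) p. 358 with `E_R = E_H + E_ζ`**: the splitting `Q = Q_k + E_A + (E_H + E_ζ)` of the form
`Q = ⟨H_{1,k}B′, Δ₁(ζ₀)H_{1,k}B′⟩` (leading form `Q_k = ⟨B′, Δ_kB′⟩` of [10], first-order error `E_A`, minimizer-replacement
error `E_H`, and the `ζ₀ → 1` error `E_ζ = −Σ_x w(x)(Tu)(x)²` — the form is `ζ`-weighted, `w = 1 − ζ₀`), the (1.67)
instance `γ₀‖∂B′‖² ≤ Q_k`, the two remaining LETTERS `|E_A| ≤ C₁M⁶R_kε_k‖B′‖²`, `|E_H| ≤ C_He^{−R_k}‖B′‖²`, and the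
HYPOTHESES of `zetaError_le_exp_Rk` for `E_ζ` (with `‖B′‖² = ‖u‖²`) give r13's leaf
`Ineq17 Q ‖∂B′‖² ‖B′‖² γ₀ (max C₁ (C_H + C²cc′)) M R_k ε_k` — by name through `B16Ineq17Assembly.ineq17_of_inputs`.
[cite: Balaban1989LargeFieldII, (1.7) pp.357–358; Balaban1984PropagatorsI, (1.67) p.29] -/
theorem ineq17_of_inputs_zeta (T : (X → ℝ) →ₗ[ℝ] (Y → ℝ)) {K : g.Site → g.Site → ℝ}
    (hT : ∀ (y y' : g.Site) (u : X → ℝ), (∀ x, blkX x ≠ y' → u x = 0) →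
      l2n (blockPiece blkY y (T u)) ≤ K y y' * l2n u)
    (hK0 : ∀ a b, 0 ≤ K a b) {C δ R c c' : ℝ} (hC : 0 ≤ C) (hδ : 0 ≤ δ) (hc : 0 ≤ c) (hc' : 0 ≤ c')
    (hK : ∀ a b, K a b ≤ C * Real.exp (-(δ * g.dist a b))) (S S' : Finset g.Site)
    (hsep : ∀ y ∈ S, ∀ y' ∈ S', R ≤ g.dist y y')
    (hrow : ∀ y ∈ S, ∑ y' ∈ S', Real.exp (-(δ / 2 * g.dist y y')) ≤ c)
    (hcol : ∀ y' ∈ S', ∑ y ∈ S, Real.exp (-(δ / 2 * g.dist y y')) ≤ c')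
    (w : Y → ℝ) (hw0 : ∀ x, 0 ≤ w x) (hw1 : ∀ x, w x ≤ 1) (hwS : ∀ x, w x ≠ 0 → blkY x ∈ S)
    (u : X → ℝ) (hu : ∀ x, blkX x ∉ S' → u x = 0)
    {Q Qk EA EH ndB γ₀ C₁ CH M Rk εk : ℝ} (hRk : Rk ≤ δ * R)
    (hQ : Q = Qk + EA + (EH + -(∑ x : Y, w x * T u x ^ 2))) (h167 : γ₀ * ndB ≤ Qk)
    (hEA : |EA| ≤ C₁ * (M ^ 6 * Rk * εk) * l2n u ^ 2) (hEH : |EH| ≤ CH * Real.exp (-Rk) * l2n u ^ 2)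
    (hX : 0 ≤ M ^ 6 * Rk * εk) :
    Ineq17 Q ndB (l2n u ^ 2) γ₀ (max C₁ (CH + C ^ 2 * c * c')) M Rk εk := by
  have hζ := zetaError_le_exp_Rk blkX blkY T hT hK0 hC hδ hc hc' hK S S' hsep hrow hcol hRk w hw0 hw1 hwS u hu
  have hER : |EH + -(∑ x : Y, w x * T u x ^ 2)| ≤ (CH + C ^ 2 * c * c') * Real.exp (-Rk) * l2n u ^ 2 := by
    have h1 := abs_add_le EH (-(∑ x : Y, w x * T u x ^ 2))
    rw [abs_neg] at h1
    have h2 : (CH + C ^ 2 * c * c') * Real.exp (-Rk) * l2n u ^ 2 =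
        CH * Real.exp (-Rk) * l2n u ^ 2 + C ^ 2 * c * c' * Real.exp (-Rk) * l2n u ^ 2 := by ring
    rw [h2]
    exact h1.trans (add_le_add hEH hζ)
  exact B16Ineq17Assembly.ineq17_of_inputs hQ h167 hEA hER hX (sq_nonneg _)

end Literature.MathematicalPhysics.QuantumFieldTheory.Balaban1983to89.B16Ineq17ZetaError

end
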